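import Mathlib
import Literature.Analysis.ODE.PolynomialExpBounds
import Literature.Analysis.ODE.LinearComparison
import HarnessLib

/-!
# Asymptotic integration of `u'' = V u + F` at an exponentially regular left end

Topic `Literature/Analysis/ODE` (namespace `Literature.Analysis.ODE`), continuing
`ExponentialTails.lean`.  On a half-line `(−∞, X']` where the coefficient is exponentially small,
`|V(x)| ≤ C_V e^{γ x}` (`γ > 0`; the horizon end of the Regge–Wheeler equation on the tortoise
line, `V = O(e^{x/2M})`), every solution of the forced equation `u'' = V u + F` whose forcing is a
polynomial up to an exponentially small error, `|F − Q| ≤ C_F e^{γ x/2}`, is itself a polynomial up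
to an exponentially small error, with the explicit representation
`u = P + ∫_{(−∞,x]}∫_{(−∞,s]} (V u + F − Q)` (`level_step`).  This is the inductive step of the
asymptotic integration of the polyharmonic chain `f_j'' = V f_j + f_{j+1}` carried out in
`PolyharmonicHalfLine.lean` (Hartman, Ch. X §1 and §17: perturbations of `y⁽ⁿ⁾ = 0` by integrable
coefficients).  Ingredients, all proved here:

* (polynomial bookkeeping is in `PolynomialExpBounds.lean`;)
* `apriori_subexp_bound` — a priori SUB-EXPONENTIAL growth `|u|, |u'| ≤ K e^{−ε x}` (any `ε > 0`)
  towards `−∞` for `u'' = V u + σ`, `σ = O(e^{γx/2})`, by the variable-coefficient Grönwall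
  inequality of `LinearComparison.lean` applied to the rescaled energy `u² + ε⁻² u'²` read
  leftwards (the rescaling makes the nilpotent part of the system `ε`-small);
* `level_step` — the decomposition.

Everything is proved; no definitions.

## References

* P. Hartman, *Ordinary Differential Equations*, SIAM Classics 38 (2002), Ch. X §1, §17
  (key `Hartman2002`).
-/

namespace Literature.Analysis.ODE

open _root_.MeasureTheory _root_.Set _root_.Filter _root_.Topology intervalIntegral Polynomial

noncomputable section

/-! ### A priori sub-exponential growth for `u'' = V u + σ` -/

/-- **A priori sub-exponential bound.** Let `V` be continuous with `|V(x)| ≤ C_V e^{γ x}` on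
`(−∞, X]` (`γ > 0`), let `σ` be continuous with `|σ(x)| ≤ C_σ e^{γ x/2}` there, and let `u` solve
`u' = w`, `w' = V u + σ` on the open half-line `(−∞, X')`, `X < X'`.  Then for every `ε > 0` there
is `K` with `|u(x)| ≤ K e^{−ε x}` and `|w(x)| ≤ K e^{−ε x}` for all `x ≤ X`: solutions grow slower
than any exponential towards `−∞`.  (Grönwall for the rescaled energy `u² + ε⁻² w²` read
leftwards: its logarithmic derivative is at most `2ε + ε⁻¹|V|`, and `∫|V| < ∞`.) [folklore] -/
theorem apriori_subexp_bound {V σ u w : ℝ → ℝ} (hV : Continuous V) {C_V γ X X' : ℝ} (hγ : 0 < γ)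
    (hVb : ∀ x ≤ X, |V x| ≤ C_V * Real.exp (γ * x)) (hXX' : X < X')
    (hσ : Continuous σ) {C_σ : ℝ} (hσb : ∀ x ≤ X, |σ x| ≤ C_σ * Real.exp (γ / 2 * x))
    (hu : ∀ x < X', HasDerivAt u (w x) x) (hw : ∀ x < X', HasDerivAt w (V x * u x + σ x) x)
    {ε : ℝ} (hε : 0 < ε) :
    ∃ K : ℝ, ∀ x ≤ X, |u x| ≤ K * Real.exp (-ε * x) ∧ |w x| ≤ K * Real.exp (-ε * x) := by
  have hC_V : 0 ≤ C_V := nonneg_of_abs_le_mul_exp (hVb X le_rfl)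
  have hC_σ : 0 ≤ C_σ := nonneg_of_abs_le_mul_exp (hσb X le_rfl)
  set c : ℝ := ε⁻¹ with hc
  have hc0 : 0 < c := inv_pos.2 hε
  have hεc : ε * c = 1 := mul_inv_cancel₀ hε.ne'
  -- leftward reparametrisation `y s = u (X - s)`
  set y : ℝ → ℝ := fun s => u (X - s) with hy
  set y' : ℝ → ℝ := fun s => -w (X - s) with hy'
  have hyd : ∀ s, 0 ≤ s → HasDerivAt y (y' s) s := by
    intro s hs
    have h1 : HasDerivAt (fun s : ℝ => X - s) (-1) s := by simpa using (hasDerivAt_id s).const_sub X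
    have h2 := (hu (X - s) (by linarith)).comp s h1
    refine (h2.congr_of_eventuallyEq (Eventually.of_forall fun _ => rfl)).congr_deriv ?_
    simp [hy']
  have hy'd : ∀ s, 0 ≤ s → HasDerivAt y' (V (X - s) * y s + σ (X - s)) s := by
    intro s hs
    have h1 : HasDerivAt (fun s : ℝ => X - s) (-1) s := by simpa using (hasDerivAt_id s).const_sub X
    have h2 := ((hw (X - s) (by linarith)).comp s h1).neg
    refine (h2.congr_of_eventuallyEq (Eventually.of_forall fun _ => rfl)).congr_deriv ?_
    simp [hy]
  -- the rescaled energy and its differential inequality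
  set g : ℝ → ℝ := fun s => y s ^ 2 + (c * y' s) ^ 2 with hg
  set g' : ℝ → ℝ := fun s => 2 * y s * y' s + 2 * (c * y' s) * (c * (V (X - s) * y s + σ (X - s)))
    with hg'
  have hgd : ∀ s, 0 ≤ s → HasDerivAt g (g' s) s := by
    intro s hs
    have h := ((hyd s hs).pow 2).add (((hy'd s hs).const_mul c).pow 2)
    refine (h.congr_of_eventuallyEq (Eventually.of_forall fun _ => rfl)).congr_deriv ?_
    simp only [hg']
    push_cast
    ring
  set A : ℝ → ℝ := fun s => c ^ 3 * σ (X - s) ^ 2 with hA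
  set β : ℝ → ℝ := fun s => 2 * ε + c * |V (X - s)| with hβ
  have hAc : Continuous A := by
    simp only [hA]
    exact continuous_const.mul ((hσ.comp (continuous_const.sub continuous_id)).pow 2)
  have hβc : Continuous β := by
    simp only [hβ]
    exact continuous_const.add
      (continuous_const.mul (continuous_abs.comp (hV.comp (continuous_const.sub continuous_id))))
  have hβ0 : ∀ s, 0 ≤ β s := fun s => by
    simp only [hβ]
    positivity
  have hA0 : ∀ s, 0 ≤ A s := fun s => by
    simp only [hA]
    positivity
  have hineq : ∀ s, g' s ≤ A s + β s * g s := by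
    intro s
    simp only [hg', hA, hβ, hg]
    set a := y s
    set b := y' s
    set v := V (X - s)
    set q := σ (X - s)
    have i1 : 2 * a * b ≤ ε * a ^ 2 + ε * (c * b) ^ 2 := by
      have h0 : 0 ≤ ε * (a - c * b) ^ 2 := by positivity
      have : ε * (a - c * b) ^ 2 = ε * a ^ 2 - 2 * (ε * c) * a * b + ε * (c * b) ^ 2 := by ring
      rw [this, hεc] at h0
      linarith
    have i2 : 2 * (c * b) * (c * (v * a)) ≤ c * |v| * (a ^ 2 + (c * b) ^ 2) := by
      have h1 : 2 * (c * b) * (c * (v * a)) = c * v * (2 * (c * b) * a) := by ring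
      have h2 : |2 * (c * b) * a| ≤ (c * b) ^ 2 + a ^ 2 := by
        rw [abs_le]
        constructor
        · nlinarith [sq_nonneg (c * b + a)]
        · nlinarith [sq_nonneg (c * b - a)]
      rw [h1]
      calc c * v * (2 * (c * b) * a) ≤ |c * v * (2 * (c * b) * a)| := le_abs_self _
        _ = c * |v| * |2 * (c * b) * a| := by
            rw [abs_mul, abs_mul, abs_of_pos hc0]
        _ ≤ c * |v| * ((c * b) ^ 2 + a ^ 2) :=
            mul_le_mul_of_nonneg_left h2 (by positivity)
        _ = c * |v| * (a ^ 2 + (c * b) ^ 2) := by ring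
    have i3 : 2 * (c * b) * (c * q) ≤ ε * (c * b) ^ 2 + c ^ 3 * q ^ 2 := by
      have h0 : 0 ≤ ε * (c * b - c * (c * q)) ^ 2 := by positivity
      have : ε * (c * b - c * (c * q)) ^ 2
          = ε * (c * b) ^ 2 - 2 * (ε * c) * (c * b) * (c * q) + (ε * c) * c ^ 3 * q ^ 2 := by ring
      rw [this, hεc] at h0
      linarith
    have hsum : 2 * a * b + 2 * (c * b) * (c * (v * a + q))
        = 2 * a * b + 2 * (c * b) * (c * (v * a)) + 2 * (c * b) * (c * q) := by ring
    rw [hsum]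
    nlinarith [i1, i2, i3, abs_nonneg v, sq_nonneg a, sq_nonneg (c * b)]
  -- Grönwall on `[0, S]`
  have hgron : ∀ S, 0 ≤ S → g S ≤ Real.exp (2 * ε * S + c * (C_V * Real.exp (γ * X) / γ))
      * (g 0 + c ^ 3 * (C_σ ^ 2 * Real.exp (γ * X) / γ)) := by
    intro S hS
    have key := le_linearComparison (a := 0) (b := S) (g := g) (g' := g') (A := A) (β := β)
      (fun s hs => (hgd s hs.1).continuousAt.continuousWithinAt)
      (fun s hs => (hgd s hs.1).hasDerivWithinAt) hAc.continuousOn hβc.continuousOn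
      (fun s _ => hineq s) (t := S) ⟨hS, le_rfl⟩
    -- bound the exponent
    have hβint : ∫ s in (0 : ℝ)..S, β s ≤ 2 * ε * S + c * (C_V * Real.exp (γ * X) / γ) := by
      have hsplit : ∫ s in (0 : ℝ)..S, β s = 2 * ε * S + c * ∫ s in (0 : ℝ)..S, |V (X - s)| := by
        have hi1 : IntervalIntegrable (fun _ : ℝ => 2 * ε) volume 0 S := intervalIntegrable_const
        have hi2 : IntervalIntegrable (fun s : ℝ => c * |V (X - s)|) volume 0 S :=
          (by fun_prop : Continuous fun s : ℝ => c * |V (X - s)|).intervalIntegrable 0 S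
        have h12 := intervalIntegral.integral_add hi1 hi2
        simp only [hβ]
        rw [h12, intervalIntegral.integral_const, intervalIntegral.integral_const_mul]
        simp only [sub_zero, smul_eq_mul]
        ring
      rw [hsplit]
      have := integral_abs_comp_sub_le hV hγ hVb hS
      nlinarith [hc0]
    -- bound the forcing integral
    have hAint : ∫ s in (0 : ℝ)..S, A s * Real.exp (-(∫ u in (0 : ℝ)..s, β u))
        ≤ c ^ 3 * (C_σ ^ 2 * Real.exp (γ * X) / γ) := by
      have h1 : ∫ s in (0 : ℝ)..S, A s * Real.exp (-(∫ u in (0 : ℝ)..s, β u))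
          ≤ ∫ s in (0 : ℝ)..S, A s := by
        have hBc : Continuous fun s => ∫ u in (0 : ℝ)..s, β u :=
          continuous_primitive (fun a b => hβc.intervalIntegrable a b) 0
        have hABc : Continuous fun s => A s * Real.exp (-(∫ u in (0 : ℝ)..s, β u)) :=
          hAc.mul hBc.neg.rexp
        refine intervalIntegral.integral_mono_on hS (hABc.intervalIntegrable _ _)
          (hAc.intervalIntegrable _ _) fun s hs => ?_
        · have hB : 0 ≤ ∫ u in (0 : ℝ)..s, β u := intervalIntegral.integral_nonneg hs.1 fun u _ => hβ0 u
          have : Real.exp (-(∫ u in (0 : ℝ)..s, β u)) ≤ 1 := Real.exp_le_one_iff.2 (by linarith)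
          calc A s * Real.exp (-(∫ u in (0 : ℝ)..s, β u)) ≤ A s * 1 :=
                mul_le_mul_of_nonneg_left this (hA0 s)
            _ = A s := mul_one _
      have h2 : ∫ s in (0 : ℝ)..S, A s ≤ c ^ 3 * (C_σ ^ 2 * Real.exp (γ * X) / γ) := by
        simp only [hA]
        rw [intervalIntegral.integral_const_mul]
        refine mul_le_mul_of_nonneg_left ?_ (by positivity)
        have hb2 : ∀ x ≤ X, |(fun x => σ x ^ 2) x| ≤ C_σ ^ 2 * Real.exp (γ * x) := by
          intro x hx
          have h := hσb x hx
          have h0 : 0 ≤ C_σ * Real.exp (γ / 2 * x) := by positivity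
          simp only
          rw [abs_of_nonneg (sq_nonneg (σ x)), ← sq_abs]
          calc |σ x| ^ 2 ≤ (C_σ * Real.exp (γ / 2 * x)) ^ 2 :=
                pow_le_pow_left₀ (abs_nonneg _) h 2
            _ = C_σ ^ 2 * Real.exp (γ * x) := by
                rw [mul_pow, ← Real.exp_nat_mul]; ring_nf
        have := integral_abs_comp_sub_le (hσ.pow 2) hγ hb2 hS
        have heq : (fun s => σ (X - s) ^ 2) = fun s => |(fun x => σ x ^ 2) (X - s)| := by
          funext s
          simp only
          rw [abs_of_nonneg (sq_nonneg (σ (X - s)))]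
        rw [heq]
        exact this
      exact h1.trans h2
    have hg0 : 0 ≤ g 0 := by simp only [hg]; positivity
    have hI0 : 0 ≤ ∫ s in (0 : ℝ)..S, A s * Real.exp (-(∫ u in (0 : ℝ)..s, β u)) :=
      intervalIntegral.integral_nonneg hS fun s _ => mul_nonneg (hA0 s) (Real.exp_pos _).le
    calc g S ≤ Real.exp (∫ s in (0 : ℝ)..S, β s)
          * (g 0 + ∫ s in (0 : ℝ)..S, A s * Real.exp (-(∫ u in (0 : ℝ)..s, β u))) := key
      _ ≤ Real.exp (2 * ε * S + c * (C_V * Real.exp (γ * X) / γ))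
          * (g 0 + c ^ 3 * (C_σ ^ 2 * Real.exp (γ * X) / γ)) :=
          mul_le_mul (Real.exp_le_exp.2 hβint) (by linarith) (add_nonneg hg0 hI0)
            (Real.exp_pos _).le
  -- read off the bounds
  set K₀ : ℝ := Real.exp (c * (C_V * Real.exp (γ * X) / γ))
      * (g 0 + c ^ 3 * (C_σ ^ 2 * Real.exp (γ * X) / γ)) with hK₀
  have hK₀0 : 0 ≤ K₀ := by
    have hg0 : 0 ≤ g 0 := by simp only [hg]; positivity
    simp only [hK₀]
    positivity
  refine ⟨(1 + ε) * Real.sqrt K₀ * Real.exp (ε * X), fun x hx => ?_⟩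
  have hS : 0 ≤ X - x := by linarith
  have hgS := hgron (X - x) hS
  have hsplit : Real.exp (2 * ε * (X - x) + c * (C_V * Real.exp (γ * X) / γ))
      * (g 0 + c ^ 3 * (C_σ ^ 2 * Real.exp (γ * X) / γ))
      = (Real.sqrt K₀ * Real.exp (ε * (X - x))) ^ 2 := by
    rw [mul_pow, Real.sq_sqrt hK₀0, ← Real.exp_nat_mul, Real.exp_add, hK₀]
    push_cast
    ring_nf
  rw [hsplit] at hgS
  have hyx : y (X - x) = u x := by simp [hy]
  have hy'x : y' (X - x) = -w x := by simp [hy']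
  have hg_def : g (X - x) = u x ^ 2 + (c * w x) ^ 2 := by
    simp only [hg, hyx, hy'x]; ring
  rw [hg_def] at hgS
  have hR : 0 ≤ Real.sqrt K₀ * Real.exp (ε * (X - x)) := by positivity
  have hu2 : u x ^ 2 ≤ (Real.sqrt K₀ * Real.exp (ε * (X - x))) ^ 2 := by
    nlinarith [sq_nonneg (c * w x)]
  have hw2 : (c * w x) ^ 2 ≤ (Real.sqrt K₀ * Real.exp (ε * (X - x))) ^ 2 := by
    nlinarith [sq_nonneg (u x)]
  have hu1 : |u x| ≤ Real.sqrt K₀ * Real.exp (ε * (X - x)) := abs_le_of_sq_le_sq hu2 hR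
  have hw1 : |c * w x| ≤ Real.sqrt K₀ * Real.exp (ε * (X - x)) := abs_le_of_sq_le_sq hw2 hR
  have hexp : Real.exp (ε * (X - x)) = Real.exp (ε * X) * Real.exp (-ε * x) := by
    rw [← Real.exp_add]; ring_nf
  obtain ⟨T, hT_def, hT0⟩ : ∃ T : ℝ, T = Real.sqrt K₀ * Real.exp (ε * X) * Real.exp (-ε * x)
      ∧ 0 ≤ T := ⟨_, rfl, by positivity⟩
  have hRT : Real.sqrt K₀ * Real.exp (ε * (X - x)) = T := by rw [hT_def, hexp, mul_assoc]
  rw [hRT] at hu1 hw1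
  have hgoal : (1 + ε) * Real.sqrt K₀ * Real.exp (ε * X) * Real.exp (-ε * x) = (1 + ε) * T := by
    rw [hT_def]; ring
  rw [hgoal]
  have hεT : 0 ≤ ε * T := mul_nonneg hε.le hT0
  constructor
  · calc |u x| ≤ T := hu1
      _ ≤ (1 + ε) * T := by linarith
  · have hwc : |w x| = ε * |c * w x| := by
      rw [abs_mul, abs_of_pos hc0, ← mul_assoc, hεc, one_mul]
    rw [hwc]
    calc ε * |c * w x| ≤ ε * T := mul_le_mul_of_nonneg_left hw1 hε.le
      _ ≤ (1 + ε) * T := by linarith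

/-! ### The inductive step: `u'' = V u + F`, `F` a polynomial up to `O(e^{γx/2})` -/

/-- **Asymptotic integration, one level.** Let `V` be continuous with `|V(x)| ≤ C_V e^{γ x}` on
`(−∞, X]` (`γ > 0`), and let `u` (continuous on `ℝ`) solve `u' = w`, `w' = V u + F` on the open
half-line `(−∞, X')`, `X < X'`, where the forcing `F` (continuous on `ℝ`) is a polynomial `Q` up
to an exponentially small error: `|F(x) − Q(x)| ≤ C_F e^{γx/2}` for `x ≤ X`.  Then there are a
polynomial `P` and a constant `C` such that, with `k = V u + (F − Q)`:
* `|k(x)| ≤ C e^{γx/2}` and `|u(x) − P(x)| ≤ C e^{γx/2}` for `x ≤ X`;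
* `u(x) = P(x) + ∫_{(−∞,x]} ∫_{(−∞,s]} k` for all `x < X'`.
(Subtract a polynomial second primitive of `Q`, bound the remainder a priori by
`apriori_subexp_bound`, integrate twice from `−∞`.) [folklore] -/
theorem level_step {V u w F : ℝ → ℝ} (hV : Continuous V) {C_V γ X X' : ℝ} (hγ : 0 < γ)
    (hVb : ∀ x ≤ X, |V x| ≤ C_V * Real.exp (γ * x)) (hXX' : X < X')
    (huc : Continuous u) (hFc : Continuous F)
    (hu : ∀ x < X', HasDerivAt u (w x) x) (hw : ∀ x < X', HasDerivAt w (V x * u x + F x) x)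
    (Q : ℝ[X]) {C_F : ℝ} (hFb : ∀ x ≤ X, |F x - Q.eval x| ≤ C_F * Real.exp (γ / 2 * x)) :
    ∃ (P : ℝ[X]) (C : ℝ),
      (∀ x ≤ X, |V x * u x + (F x - Q.eval x)| ≤ C * Real.exp (γ / 2 * x)) ∧
      (∀ x ≤ X, |u x - P.eval x| ≤ C * Real.exp (γ / 2 * x)) ∧
      (∀ x < X', u x = P.eval x
        + ∫ s in Iic x, ∫ σ in Iic s, (V σ * u σ + (F σ - Q.eval σ))) := by
  have hC_V : 0 ≤ C_V := nonneg_of_abs_le_mul_exp (hVb X le_rfl)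
  have hC_F : 0 ≤ C_F := nonneg_of_abs_le_mul_exp (hFb X le_rfl)
  have hγ2 : 0 < γ / 2 := by positivity
  -- a polynomial second primitive of `Q`
  obtain ⟨P₀, hP₀⟩ := exists_polynomial_derivative_derivative_eq Q
  have hP₀d : ∀ x, HasDerivAt (fun x => P₀.eval x) ((derivative P₀).eval x) x :=
    fun x => P₀.hasDerivAt x
  have hP₁d : ∀ x, HasDerivAt (fun x => (derivative P₀).eval x) (Q.eval x) x := fun x => by
    simpa [hP₀] using (derivative P₀).hasDerivAt x
  -- the remainder `v = u - P₀` solves `v'' = V v + σ`, `σ = V P₀ + (F - Q)`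
  set v : ℝ → ℝ := fun x => u x - P₀.eval x with hv
  set v' : ℝ → ℝ := fun x => w x - (derivative P₀).eval x with hv'
  set σ : ℝ → ℝ := fun x => V x * P₀.eval x + (F x - Q.eval x) with hσ
  have hvd : ∀ x < X', HasDerivAt v (v' x) x := fun x hx => (hu x hx).sub (hP₀d x)
  have hv'd : ∀ x < X', HasDerivAt v' (V x * v x + σ x) x := fun x hx => by
    have h := (hw x hx).sub (hP₁d x)
    refine h.congr_deriv ?_
    simp only [hv, hσ]
    ring
  have hσc : Continuous σ := by
    simp only [hσ]
    exact (hV.mul P₀.continuous).add (hFc.sub Q.continuous)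
  obtain ⟨C_P, hC_P, hPb⟩ := exists_abs_eval_le_mul_exp_neg P₀ hγ2 X
  have hσb : ∀ x ≤ X, |σ x| ≤ (C_V * C_P + C_F) * Real.exp (γ / 2 * x) := by
    intro x hx
    have h1 : |V x * P₀.eval x| ≤ C_V * C_P * Real.exp ((γ + -(γ / 2)) * x) :=
      abs_mul_le_mul_exp_add (hVb x hx) (hPb x hx)
    rw [show γ + -(γ / 2) = γ / 2 by ring] at h1
    exact abs_add_le_mul_exp h1 (hFb x hx)
  -- a priori bound with `ε = γ/4`
  have hγ4 : 0 < γ / 4 := by positivity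
  obtain ⟨K, hK⟩ := apriori_subexp_bound hV hγ hVb hXX' hσc hσb hvd hv'd hγ4
  have hK0 : 0 ≤ K := by
    have := (hK X le_rfl).1
    exact nonneg_of_abs_le_mul_exp (lam := -(γ / 4)) (by simpa using this)
  -- the integrand `k = V v + σ = V u + (F - Q)` is `O(e^{γx/2})`
  set k : ℝ → ℝ := fun x => V x * u x + (F x - Q.eval x) with hk
  have hk_eq : ∀ x, k x = V x * v x + σ x := fun x => by
    simp only [hk, hv, hσ]; ring
  have hkc : Continuous k := by
    simp only [hk]
    exact (hV.mul huc).add (hFc.sub Q.continuous)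
  set C_k : ℝ := C_V * K * Real.exp (γ / 4 * X) + (C_V * C_P + C_F) with hC_k
  have hkb : ∀ x ≤ X, |k x| ≤ C_k * Real.exp (γ / 2 * x) := by
    intro x hx
    rw [hk_eq x]
    have h1 : |V x * v x| ≤ C_V * K * Real.exp ((γ + -(γ / 4)) * x) :=
      abs_mul_le_mul_exp_add (hVb x hx) (by simpa using (hK x hx).1)
    have h2 : C_V * K * Real.exp ((γ + -(γ / 4)) * x)
        ≤ C_V * K * Real.exp ((γ + -(γ / 4) - γ / 2) * X) * Real.exp (γ / 2 * x) :=
      mul_exp_le_mul_exp_of_rate_le (mul_nonneg hC_V hK0) (by linarith) hx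
    rw [show γ + -(γ / 4) - γ / 2 = γ / 4 by ring] at h2
    exact abs_add_le_mul_exp (h1.trans h2) (hσb x hx)
  -- integrate twice from `−∞`
  have hv'd' : ∀ x < X', HasDerivAt v' (k x) x := fun x hx => by
    rw [hk_eq]; exact hv'd x hx
  obtain ⟨α, β, hvrep, -⟩ := exists_affine_add_leftTail2 hγ2 hkc hkb hvd hv'd'
  refine ⟨P₀ + Polynomial.C α + Polynomial.C β * Polynomial.X,
    max C_k (C_k / (γ / 2) ^ 2), fun x hx => (hkb x hx).trans ?_, fun x hx => ?_, fun x hx => ?_⟩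
  · exact mul_le_mul_of_nonneg_right (le_max_left _ _) (Real.exp_pos _).le
  · -- `u - P = ∫∫ k` on `x ≤ X < X'`
    have hrep := hvrep x (lt_of_le_of_lt hx hXX')
    simp only [hv] at hrep
    have : u x - (P₀ + Polynomial.C α + Polynomial.C β * Polynomial.X).eval x
        = ∫ s in Iic x, ∫ σ' in Iic s, k σ' := by
      simp only [eval_add, eval_mul, eval_C, eval_X]
      linarith
    rw [this]
    exact (abs_leftTail2_le hγ2 hkc hkb hx).trans
      (mul_le_mul_of_nonneg_right (le_max_right _ _) (Real.exp_pos _).le)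
  · have hrep := hvrep x hx
    simp only [hv] at hrep
    simp only [eval_add, eval_mul, eval_C, eval_X]
    linarith

end

end Literature.Analysis.ODE
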